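import Summits.ValiantsHypothesis.ValiantsHypothesis.Theorems.MonotoneRestorationOrbitCompressionQPOrbitToNarrowOfDescent
import Summits.ValiantsHypothesis.ValiantsHypothesis.Theorems.MonotoneRestorationOrbitCompressionQPTwoSortedPassage
import HarnessLib

/-!
# Route MonotoneRestoration — aside `OrbitCompressionQP` (stmt-ValiantsHypothesis-18332), line
# `expression_compression`: REYNOLDS DESCENT — the repaired first stub from a PATTERN-BY-PATTERN statement

`Theorems/…OrbitToNarrowOfDescent.lean` reduces the repaired first stub of line `expression_compression` to
quasi-polynomial DESCENT (a MATRIX-symmetric member of the one-sorted narrow span lies in the bipartite narrow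
span, polylog loss in the width).  Descent quantifies over all matrix-symmetric COMBINATIONS of one-sorted
homomorphism polynomials.  This file replaces it by a statement about SINGLE PATTERNS: the Reynolds operator
of `Sym_n × Sym_n` (the sum of all `x_{ij} ↦ x_{σ i, τ j}` renamings) fixes matrix-symmetric polynomials up to
the factor `(n!)²` and is linear, so

  **REYNOLDS qp-DESCENT** — for every `c` there is `c'` such that for every level `n` and every directed
  looped pattern `D` of treewidth `≤ (log₂ n + c)^c`, the Reynolds sum of `dihom_{D,n}` lies in the span of
  the bipartite `hom_{F,n}` of treewidth `≤ (log₂ n + c')^{c'}` —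

implies qp-descent (all levels, all degrees), hence the repaired first stub in full, hence the aside modulo
its registered second stub.  Reynolds descent is attackable and refutable one pattern at a time.

* `mem_of_reynolds_mem` — the abstract reduction: if the Reynolds sum of every generator of `S` lies in a
  subspace `W`, every matrix-symmetric member of `span S` lies in `W`;
* `reynolds_diHomPoly_mem_span_of_card` — the VERTEX-BUDGET case, unconditionally: the Reynolds sum of
  `dihom_{D,n}` for `D` on `a` vertices lies in the span of the `hom_{F,n}` with `≤ a` rows and `≤ a` columns
  (hence treewidth `≤ 2a - 1`; the three-budget spanning theorem of `…TwoSortedPassage`);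
* ★ `qpDescent_of_reynoldsDescent` — Reynolds qp-descent ⟹ qp-descent;
* ★ `orbitToNarrowExpression_of_reynoldsDescent` — Reynolds qp-descent ⟹ the repaired Stub 1 (verbatim
  conclusion of the registered `stub_orbitToNarrowExpression`, every matrix-symmetric family);
* `orbitCompressionQP_of_reynoldsDescent_of_stub2` — Reynolds qp-descent + registered Stub 2 ⟹ the aside
  `OrbitCompressionQP`, by name.

Honest label: a reduction; Reynolds qp-descent is NOT proved (nor known to be true: it is stronger than
descent), the aside and VP ≠ VNP are not moved.  Helper file (`--supports stmt-ValiantsHypothesis-18332`);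
def-free; nothing here is a named fact.

References: Dawar–Pago–Seppelt 2025 (arXiv:2502.06740) Remark p. 17, §7 p. 45; Dwivedi–Pago–Seppelt 2026
(arXiv:2601.09343) §8.
-/

noncomputable section

open scoped Classical

-- `Summit.ValiantsHypothesis.ValiantsHypothesis.…` is the tree's single-conjunct layout (Sub = Summit).
set_option linter.dupNamespace false

namespace Summit.ValiantsHypothesis.ValiantsHypothesis.Theorems

namespace ReynoldsDescent

open Literature.Computability.AlgebraicComplexity MvPolynomial
open Literature.Combinatorics.SimpleGraph (treewidth)

/-! ### The abstract Reynolds reduction -/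

/-- **Reynolds reduction.**  If the Reynolds sum over `Sym_n × Sym_n` of every member of a set `S` of
polynomials on the `n × n` matrix lies in a subspace `W`, then every MATRIX-symmetric polynomial in the span
of `S` lies in `W` (the Reynolds sum is linear and equals `(n!)² • p` on a matrix-symmetric `p`). [folklore] -/
theorem mem_of_reynolds_mem {n : ℕ} (S : Set (MvPolynomial (Fin n × Fin n) ℂ))
    (W : Submodule ℂ (MvPolynomial (Fin n × Fin n) ℂ))
    (hS : ∀ q ∈ S, (∑ g : Equiv.Perm (Fin n) × Equiv.Perm (Fin n),
        rename (fun ij : Fin n × Fin n => (g.1 ij.1, g.2 ij.2)) q) ∈ W)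
    (p : MvPolynomial (Fin n × Fin n) ℂ)
    (hp : ∀ σ τ : Equiv.Perm (Fin n), rename (fun ij : Fin n × Fin n => (σ ij.1, τ ij.2)) p = p)
    (hmem : p ∈ Submodule.span ℂ S) : p ∈ W := by
  classical
  have key : ∀ q ∈ Submodule.span ℂ S, (∑ g : Equiv.Perm (Fin n) × Equiv.Perm (Fin n),
      rename (fun ij : Fin n × Fin n => (g.1 ij.1, g.2 ij.2)) q) ∈ W := by
    intro q hq
    refine Submodule.span_induction (p := fun q _ => (∑ g : Equiv.Perm (Fin n) × Equiv.Perm (Fin n),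
        rename (fun ij : Fin n × Fin n => (g.1 ij.1, g.2 ij.2)) q) ∈ W) hS (by simp)
      (fun x y _ _ hx hy => ?_) (fun c x _ hx => ?_) hq
    · simp only [map_add, Finset.sum_add_distrib]
      exact W.add_mem hx hy
    · simp only [map_smul, ← Finset.smul_sum]
      exact W.smul_mem _ hx
  have hG : (Fintype.card (Equiv.Perm (Fin n) × Equiv.Perm (Fin n)) : ℂ) ≠ 0 :=
    Nat.cast_ne_zero.2 Fintype.card_ne_zero
  have h := key p hmem
  rw [TwoSortedPassage.reynolds_of_matrixSymmetric p hp] at h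
  have := W.smul_mem ((Fintype.card (Equiv.Perm (Fin n) × Equiv.Perm (Fin n)) : ℂ)⁻¹) h
  rwa [smul_smul, inv_mul_cancel₀ hG, one_smul] at this

/-! ### The vertex-budget case of Reynolds descent (unconditional) -/

/-- **Reynolds descent with a vertex budget.**  The Reynolds sum over `Sym_n × Sym_n` of the one-sorted
homomorphism polynomial `dihom_{D,n}` of a directed looped pattern `D` on `a` vertices lies in the span of
the bipartite `hom_{F,n}` with `≤ a` row vertices and `≤ a` column vertices.
[cite: DwivediPagoSeppelt2026, §8 (Lemma 8.18)] -/
theorem reynolds_diHomPoly_mem_span_of_card {n a : ℕ} (D : Multiset (Fin a × Fin a)) :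
    (∑ g : Equiv.Perm (Fin n) × Equiv.Perm (Fin n),
        rename (fun ij : Fin n × Fin n => (g.1 ij.1, g.2 ij.2)) (diHomPoly D n ℂ)) ∈
      Submodule.span ℂ {q : MvPolynomial (Fin n × Fin n) ℂ | ∃ (a' b' : ℕ) (F : Multiset (Fin a' × Fin b')),
        a' ≤ a ∧ b' ≤ a ∧ q = homPoly F n ℂ} := by
  classical
  have hrc : ∀ M ∈ (∑ g : Equiv.Perm (Fin n) × Equiv.Perm (Fin n),
      rename (fun ij : Fin n × Fin n => (g.1 ij.1, g.2 ij.2)) (diHomPoly D n ℂ)).support,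
      (M.support.image Prod.fst).card ≤ a ∧ (M.support.image Prod.snd).card ≤ a :=
    fun M hM => TwoSortedPassage.rows_cols_le_of_mem_support_reynolds (r := a) (s := a) _
      (fun M' hM' => (TwoSortedPassage.rows_cols_le_of_mem_support_diHom (n := n) D hM').1)
      (fun M' hM' => (TwoSortedPassage.rows_cols_le_of_mem_support_diHom (n := n) D hM').2) hM
  refine Submodule.span_mono ?_ (TwoSortedPassage.mem_span_homPoly_of_rows_cols_le _
    (TwoSortedPassage.rename_reynolds _) (fun M hM => (hrc M hM).1) (fun M hM => (hrc M hM).2))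
  rintro q ⟨a', b', F, ha', hb', -, rfl⟩
  exact ⟨a', b', F, ha', hb', rfl⟩

/-- **Treewidth form of the vertex-budget case**: the Reynolds sum of `dihom_{D,n}`, `D` on `a` vertices,
lies in the bipartite narrow span of width `2a - 1`. [folklore] -/
theorem reynolds_diHomPoly_mem_narrowSpan_of_card {n a : ℕ} (D : Multiset (Fin a × Fin a)) :
    (∑ g : Equiv.Perm (Fin n) × Equiv.Perm (Fin n),
        rename (fun ij : Fin n × Fin n => (g.1 ij.1, g.2 ij.2)) (diHomPoly D n ℂ)) ∈
      Submodule.span ℂ {q : MvPolynomial (Fin n × Fin n) ℂ | ∃ (a' b' : ℕ) (F : Multiset (Fin a' × Fin b')),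
        treewidth (SimpleGraph.fromRel fun u v : Fin a' ⊕ Fin b' =>
            ∃ e ∈ F, u = Sum.inl e.1 ∧ v = Sum.inr e.2) ≤ 2 * a - 1 ∧ q = homPoly F n ℂ} := by
  refine Submodule.span_mono ?_ (reynolds_diHomPoly_mem_span_of_card D)
  rintro q ⟨a', b', F, ha', hb', rfl⟩
  refine ⟨a', b', F, (Literature.Combinatorics.SimpleGraph.treewidth_le_card_sub_one _).trans ?_, rfl⟩
  simp only [Fintype.card_sum, Fintype.card_fin]
  omega

/-! ### Reynolds qp-descent ⟹ qp-descent ⟹ the repaired first stub -/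

/-- ★ **REYNOLDS qp-DESCENT ⟹ qp-DESCENT** (all levels, all degrees). [folklore] -/
theorem qpDescent_of_reynoldsDescent
    (hR : ∀ c : ℕ, ∃ c' : ℕ, ∀ (n a : ℕ) (D : Multiset (Fin a × Fin a)),
      treewidth (SimpleGraph.fromRel fun u v : Fin a => ∃ e ∈ D, u = e.1 ∧ v = e.2) ≤
        (Nat.log 2 n + c) ^ c →
      (∑ g : Equiv.Perm (Fin n) × Equiv.Perm (Fin n),
          rename (fun ij : Fin n × Fin n => (g.1 ij.1, g.2 ij.2)) (diHomPoly D n ℂ)) ∈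
        Submodule.span ℂ {q : MvPolynomial (Fin n × Fin n) ℂ | ∃ (a' b' : ℕ) (F : Multiset (Fin a' × Fin b')),
          treewidth (SimpleGraph.fromRel fun u v : Fin a' ⊕ Fin b' =>
              ∃ e ∈ F, u = Sum.inl e.1 ∧ v = Sum.inr e.2) ≤ (Nat.log 2 n + c') ^ c' ∧ q = homPoly F n ℂ}) :
    ∀ c : ℕ, ∃ c' : ℕ, ∀ (n : ℕ) (p : MvPolynomial (Fin n × Fin n) ℂ),
      (∀ σ τ : Equiv.Perm (Fin n), rename (fun ij : Fin n × Fin n => (σ ij.1, τ ij.2)) p = p) →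
      p ∈ Submodule.span ℂ {q : MvPolynomial (Fin n × Fin n) ℂ |
        ∃ (a : ℕ) (D : Multiset (Fin a × Fin a)),
          treewidth (SimpleGraph.fromRel fun u v : Fin a => ∃ e ∈ D, u = e.1 ∧ v = e.2) ≤
            (Nat.log 2 n + c) ^ c ∧ q = diHomPoly D n ℂ} →
      p ∈ Submodule.span ℂ {q : MvPolynomial (Fin n × Fin n) ℂ | ∃ (a b : ℕ) (F : Multiset (Fin a × Fin b)),
        treewidth (SimpleGraph.fromRel fun u v : Fin a ⊕ Fin b =>
            ∃ e ∈ F, u = Sum.inl e.1 ∧ v = Sum.inr e.2) ≤ (Nat.log 2 n + c') ^ c' ∧ q = homPoly F n ℂ} := by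
  intro c
  obtain ⟨c', hc'⟩ := hR c
  refine ⟨c', fun n p hp hmem => mem_of_reynolds_mem _ _ ?_ p hp hmem⟩
  rintro q ⟨a, D, hD, rfl⟩
  exact hc' n a D hD

/-- ★ **REYNOLDS qp-DESCENT ⟹ THE REPAIRED STUB 1** (verbatim conclusion of the registered
`stub_orbitToNarrowExpression`, for every matrix-symmetric family with square-symmetric circuits of
quasi-polynomial orbit size). [cite: DawarPagoSeppelt2025, Theorem 1.1 and §7 (p. 45)] -/
theorem orbitToNarrowExpression_of_reynoldsDescent
    (hR : ∀ c : ℕ, ∃ c' : ℕ, ∀ (n a : ℕ) (D : Multiset (Fin a × Fin a)),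
      treewidth (SimpleGraph.fromRel fun u v : Fin a => ∃ e ∈ D, u = e.1 ∧ v = e.2) ≤
        (Nat.log 2 n + c) ^ c →
      (∑ g : Equiv.Perm (Fin n) × Equiv.Perm (Fin n),
          rename (fun ij : Fin n × Fin n => (g.1 ij.1, g.2 ij.2)) (diHomPoly D n ℂ)) ∈
        Submodule.span ℂ {q : MvPolynomial (Fin n × Fin n) ℂ | ∃ (a' b' : ℕ) (F : Multiset (Fin a' × Fin b')),
          treewidth (SimpleGraph.fromRel fun u v : Fin a' ⊕ Fin b' =>
              ∃ e ∈ F, u = Sum.inl e.1 ∧ v = Sum.inr e.2) ≤ (Nat.log 2 n + c') ^ c' ∧ q = homPoly F n ℂ})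
    (f : (n : ℕ) → MvPolynomial (Fin n × Fin n) ℂ)
    (hsymm : ∀ (n : ℕ) (σ τ : Equiv.Perm (Fin n)),
      rename (fun ij : Fin n × Fin n => (σ ij.1, τ ij.2)) (f n) = f n)
    (horb : ∃ c : ℕ, ∀ n : ℕ, ∃ (G : Type) (_ : Fintype G)
        (C : LabelledArithCircuit ℂ (Fin n × Fin n) Unit G),
      C.IsSymmetric (Equiv.Perm (Fin n)) ∧ C.eval (C.output ()) = f n ∧
      C.orbitSize (Equiv.Perm (Fin n)) ≤ 2 ^ ((Nat.log 2 n + c) ^ c)) :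
    ∃ c : ℕ, ∀ n : ℕ, 1 ≤ n → ∃ (k l : ℕ) (e : PatternExpr ℂ k l),
      n ^ (k + l) ≤ 2 ^ ((Nat.log 2 n + c) ^ c) ∧ e.close n = f n := by
  refine OrbitToNarrowOfDescent.orbitToNarrowExpression_of_qpDescent (fun c => ?_) f hsymm horb
  obtain ⟨c', hc'⟩ := qpDescent_of_reynoldsDescent hR c
  exact ⟨c', fun n p hp _ hmem => hc' n p hp hmem⟩

/-- **Reynolds qp-descent + the registered Stub 2 ⟹ the aside `OrbitCompressionQP`**, by name.
[cite: DwivediPagoSeppelt2026, Outlook Q3] [cite: DawarPagoSeppelt2025, §5] -/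
theorem orbitCompressionQP_of_reynoldsDescent_of_stub2
    (hR : ∀ c : ℕ, ∃ c' : ℕ, ∀ (n a : ℕ) (D : Multiset (Fin a × Fin a)),
      treewidth (SimpleGraph.fromRel fun u v : Fin a => ∃ e ∈ D, u = e.1 ∧ v = e.2) ≤
        (Nat.log 2 n + c) ^ c →
      (∑ g : Equiv.Perm (Fin n) × Equiv.Perm (Fin n),
          rename (fun ij : Fin n × Fin n => (g.1 ij.1, g.2 ij.2)) (diHomPoly D n ℂ)) ∈
        Submodule.span ℂ {q : MvPolynomial (Fin n × Fin n) ℂ | ∃ (a' b' : ℕ) (F : Multiset (Fin a' × Fin b')),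
          treewidth (SimpleGraph.fromRel fun u v : Fin a' ⊕ Fin b' =>
              ∃ e ∈ F, u = Sum.inl e.1 ∧ v = Sum.inr e.2) ≤ (Nat.log 2 n + c') ^ c' ∧ q = homPoly F n ℂ})
    (stub2 : ∀ f : (n : ℕ) → MvPolynomial (Fin n × Fin n) ℂ,
      (∀ (n : ℕ) (σ τ : Equiv.Perm (Fin n)),
        MvPolynomial.rename (fun p : Fin n × Fin n => (σ p.1, τ p.2)) (f n) = f n) →
      IsVPFamily f →
      (∃ c : ℕ, ∀ n : ℕ, 1 ≤ n → ∃ (k l : ℕ) (e : PatternExpr ℂ k l),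
        n ^ (k + l) ≤ 2 ^ ((Nat.log 2 n + c) ^ c) ∧ e.close n = f n) →
      ∃ c : ℕ, ∀ n : ℕ, 1 ≤ n → ∃ (k l : ℕ) (e : PatternExpr ℂ k l),
        n ^ (k + l) ≤ 2 ^ ((Nat.log 2 n + c) ^ c) ∧ e.length ≤ 2 ^ ((Nat.log 2 n + c) ^ c) ∧
        e.close n = f n) :
    Summit.ValiantsHypothesis.ValiantsHypothesis.Theses.MonotoneRestoration.OrbitCompressionQP :=
  fun f hsymm hVP horb =>
    qpSymmetric_patternExpr f (stub2 f hsymm hVP (orbitToNarrowExpression_of_reynoldsDescent hR f hsymm horb))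

end ReynoldsDescent

end Summit.ValiantsHypothesis.ValiantsHypothesis.Theorems

end
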